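import Summits.CriticalPhenomena.SAWScalingLimit.Theorems.SAWDevelopingMapObservableToSLETypeLadderCarvedReductionSqueezeZoneGeom
import Summits.CriticalPhenomena.SAWScalingLimit.Theorems.SAWDevelopingMapObservableToSLETypeLadderCarvedReductionSqueezeSuperSup
import HarnessLib

/-!
# The window strips and the local boundary structure of the super-domain (piece (T-A′₂F strips)
# of stub T-A′₂F `stub_carvedReduction_squeezeGeometry_domainsCoreF`)

Crux `SAWDevelopingMap.ObservableToSLE` (stmt-CriticalPhenomena-10472), line `six-class-type-ladder`,
stub T-A′₂F `stub_carvedReduction_squeezeGeometry_domainsCoreF`.  Landing target: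
`Summits/CriticalPhenomena/SAWScalingLimit/Theorems/SAWDevelopingMapObservableToSLETypeLadderCarvedReductionSqueezeStrips.lean`.

Near a gate `P` of the super-domain `E` (`superSup`: flat window of radius `ρ/2`, frame box
`gateRect P ρ ⊆ Eᶜ`, cuts inside `gateO ∪ frame ∪ {xx}`) the set
`gateV P ρ t = (ball P (ρ/4) ∩ {im > im P - t}) ∖ gateRect P ρ` (`t ≤ ρ/128`) misses the cuts,
lies in `closure (D - τ) ⊆ J`, and misses the closures of the `s`-zones for `t ≤ s`
(`gateV_disjoint_closure_sideZone`: its points are within `t` of the open upper half-window,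
which lies in the bulk `Ω`, itself `s`-far from the `s`-zone); every point of the narrower
`gateW P ρ t` (radius `ρ/8`) is joined to `P + (ρ/16) i` inside `gateV P ρ t` by a vertical
dodge of the box (`joinedIn_gateV`).  The regions `X(t) = Ω ∪ ⋃ᵢ pathComponentIn (gateV Pᵢ ρ t) bᵢ`
are the `X_n` of `outerSeq`, and `localBoundaryStructure` is its hypothesis (LBS): near every
point of `∂E ⊆ L₀ ∪ L₁ ∪ ∂J`, `E` lies in the zone `Z(σ, c)` (corridor pieces, deep frame points,
and — for `∂J`, the exit regions and the cut ends, all a fixed distance off `closure (D - τ)` —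
one collar, `exists_subset_collarZone_of_isCompact`) or in a window strip `gateW Pᵢ ρ (2σ)`
(frame points of depth `≤ σ`).
Registered carrier: `stub_carvedReduction_strips`.
-/

noncomputable section

open scoped Topology
open Filter Set Metric Bornology
open Literature.Probability.RandomPlanarGeometry

namespace Summit.CriticalPhenomena.SAWScalingLimit.Theorems.ObservableToSLE.TypeLadder

/-! ### The bulk is `s`-far from the closure of the `s`-zone -/

section Far

variable {N : ℕ} {P : ℂ} {ρ : ℝ} {Ksp B : Set ℂ} {cell conn : Fin N → ℂ × ℝ} {Ω : Set ℂ}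

/-- If the unshrunk zone misses `Ω`, the closure of the `s`-zone is `s`-far from `Ω`
(thickening rule). -/
theorem le_dist_of_mem_closure_sideZone (hΩ : Disjoint Ω (sideZone P ρ Ksp B cell conn 0)) {s : ℝ} {z w : ℂ}
    (hz : z ∈ closure (sideZone P ρ Ksp B cell conn s)) (hw : w ∈ Ω) : s ≤ dist z w := by
  by_contra h
  push Not at h
  exact disjoint_left.1 hΩ hw (mem_sideZone_of_mem_closure hz (by rw [dist_comm]; linarith))

end Far

/-! ### The window strips -/

/-- The wide window region of the gate `P` at depth `t`: radius `ρ/4`, above `im P - t`, off the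
frame box. -/
def gateV (P : ℂ) (ρ t : ℝ) : Set ℂ := (ball P (ρ / 4) ∩ {z : ℂ | P.im - t < z.im}) \ gateRect P ρ

/-- The narrow window strip of the gate `P` at depth `t`: radius `ρ/8`. -/
def gateW (P : ℂ) (ρ t : ℝ) : Set ℂ := (ball P (ρ / 8) ∩ {z : ℂ | P.im - t < z.im}) \ gateRect P ρ

section Strips

variable {P : ℂ} {ρ t : ℝ}

/-- `gateW ⊆ gateV`. -/
theorem gateW_subset_gateV (hρ : 0 < ρ) : gateW P ρ t ⊆ gateV P ρ t := fun z hz =>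
  ⟨⟨ball_subset_ball (by linarith) hz.1.1, hz.1.2⟩, hz.2⟩

/-- `gateV ⊆ ball P (ρ/4)`. -/
theorem gateV_subset_ball : gateV P ρ t ⊆ ball P (ρ / 4) := fun _ hz => hz.1.1

/-- A point of `gateV` at or below the gate line is beside the box: `ρ/64 < |re z - re P|`
(`t ≤ ρ/128`). -/
theorem abs_re_gt_of_mem_gateV (ht : t ≤ ρ / 128) {z : ℂ} (hz : z ∈ gateV P ρ t) (hzim : z.im ≤ P.im) :
    ρ / 64 < |z.re - P.re| := by
  by_contra h
  push Not at h
  have h1 : P.im - t < z.im := hz.1.2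
  exact hz.2 ⟨h, by linarith, hzim⟩

/-- The open upper half-window point `P + (ρ/16) i`. -/
theorem base_mem_gateW (hρ : 0 < ρ) (ht : 0 < t) : P + ((ρ / 16 : ℝ) : ℂ) * Complex.I ∈ gateW P ρ t := by
  refine ⟨⟨?_, ?_⟩, fun h => ?_⟩
  · rw [mem_ball, dist_eq_norm, add_sub_cancel_left, norm_mul, Complex.norm_real, Complex.norm_I, mul_one,
      Real.norm_eq_abs, abs_of_pos (by positivity)]
    linarith
  · show P.im - t < (P + ((ρ / 16 : ℝ) : ℂ) * Complex.I).im
    simp; linarith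
  · have := h.2.2
    simp at this
    linarith

/-- **The vertical dodge**: every point of the narrow strip is joined to `P + (ρ/16) i` inside the
wide region (`0 < t ≤ ρ/128`). -/
theorem joinedIn_gateV (hρ : 0 < ρ) (ht : 0 < t) (ht' : t ≤ ρ / 128) {z : ℂ} (hz : z ∈ gateW P ρ t) :
    JoinedIn (gateV P ρ t) z (P + ((ρ / 16 : ℝ) : ℂ) * Complex.I) := by
  set b : ℂ := P + ((ρ / 16 : ℝ) : ℂ) * Complex.I with hb
  -- the open upper half-window of radius `ρ/4` is convex, inside `gateV`, and contains `b`
  set H : Set ℂ := {w : ℂ | P.im < w.im} ∩ ball P (ρ / 4) with hH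
  have hHc : Convex ℝ H := (convex_halfSpace_im_gt _).inter (convex_ball _ _)
  have hHV : H ⊆ gateV P ρ t := fun w hw =>
    ⟨⟨hw.2, show P.im - t < w.im by have := hw.1; simp only [mem_setOf_eq] at this; linarith⟩,
      fun h => by have := h.2.2; have := hw.1; simp only [mem_setOf_eq] at *; linarith⟩
  have hbH : b ∈ H := by
    refine ⟨?_, ?_⟩
    · show P.im < b.im; rw [hb]; simp; positivity
    · rw [mem_ball, hb, dist_eq_norm, add_sub_cancel_left, norm_mul, Complex.norm_real, Complex.norm_I, mul_one,
        Real.norm_eq_abs, abs_of_pos (by positivity)]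
      linarith
  have hzre : |z.re - P.re| < ρ / 8 := by
    have h1 : dist z P < ρ / 8 := mem_ball.1 hz.1.1
    rw [dist_eq_norm] at h1
    have h2 := Complex.abs_re_le_norm (z - P)
    rw [Complex.sub_re] at h2
    linarith
  by_cases hzim : P.im < z.im
  · exact JoinedIn.of_segment_subset ((hHc.segment_subset ⟨hzim, ball_subset_ball (by linarith) hz.1.1⟩ hbH).trans hHV)
  · push Not at hzim
    have hbox := abs_re_gt_of_mem_gateV ht' (gateW_subset_gateV hρ hz) hzim
    -- the dodge point above `z`
    set z₁ : ℂ := ⟨z.re, P.im + ρ / 16⟩ with hz₁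
    have hz₁H : z₁ ∈ H := by
      refine ⟨show P.im < z₁.im by rw [hz₁]; dsimp; linarith, ?_⟩
      rw [mem_ball, dist_eq_norm]
      refine lt_of_le_of_lt (Complex.norm_le_abs_re_add_abs_im _) ?_
      have : (z₁ - P).im = ρ / 16 := by rw [hz₁]; simp
      rw [Complex.sub_re, this, abs_of_pos (by positivity : (0 : ℝ) < ρ / 16)]
      have : z₁.re = z.re := rfl
      rw [this]; linarith
    -- the vertical segment `[z, z₁]` lies in `gateV`
    have hvert : segment ℝ z z₁ ⊆ gateV P ρ t := by
      rw [segment_eq_image']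
      rintro _ ⟨θ, ⟨hθ0, hθ1⟩, rfl⟩
      have hre : (z + θ • (z₁ - z)).re = z.re := by rw [hz₁]; simp
      have him : (z + θ • (z₁ - z)).im = z.im + θ * (P.im + ρ / 16 - z.im) := by rw [hz₁]; simp
      have hzlow : P.im - t < z.im := hz.1.2
      refine ⟨⟨?_, ?_⟩, fun h => ?_⟩
      · rw [mem_ball, dist_eq_norm]
        refine lt_of_le_of_lt (Complex.norm_le_abs_re_add_abs_im _) ?_
        rw [Complex.sub_re, Complex.sub_im, hre, him]
        have h2 : |z.im + θ * (P.im + ρ / 16 - z.im) - P.im| ≤ ρ / 16 + t := by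
          rw [abs_le]; constructor <;> nlinarith
        linarith
      · show P.im - t < (z + θ • (z₁ - z)).im
        rw [him]; nlinarith
      · have h3 := h.1
        rw [hre] at h3
        linarith
    refine (JoinedIn.of_segment_subset hvert).trans ?_
    exact JoinedIn.of_segment_subset ((hHc.segment_subset hz₁H hbH).trans hHV)

/-- **`gateV` misses the closure of the `s`-zone** (`0 < t ≤ s`): its points are within `t` of the
open upper half-window of radius `ρ/2`, which lies in `Ω`, `s`-far from the zone. -/
theorem gateV_disjoint_closure_sideZone {N : ℕ} {P' : ℂ} {Ksp B : Set ℂ} {cell conn : Fin N → ℂ × ℝ} {Ω : Set ℂ}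
    {s : ℝ} (hΩ : Disjoint Ω (sideZone P' ρ Ksp B cell conn 0))
    (hwin : {z : ℂ | P.im < z.im} ∩ ball P (ρ / 2) ⊆ Ω) (ht : 0 < t) (hts : t ≤ s) (htρ : t ≤ ρ / 4) :
    Disjoint (gateV P ρ t) (closure (sideZone P' ρ Ksp B cell conn s)) := by
  rw [disjoint_left]
  intro z hz hzcl
  have hzP : dist z P < ρ / 4 := mem_ball.1 hz.1.1
  by_cases hzim : P.im < z.im
  · have h := le_dist_of_mem_closure_sideZone hΩ hzcl (hwin ⟨hzim, mem_ball.2 (by linarith)⟩)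
    rw [dist_self] at h
    linarith
  · push Not at hzim
    have hzlow : P.im - t < z.im := hz.1.2
    set τ' : ℝ := (t - (P.im - z.im)) / 2 with hτ'
    have hτ'0 : 0 < τ' := by rw [hτ']; linarith
    set w : ℂ := z + (((P.im - z.im) + τ' : ℝ) : ℂ) * Complex.I with hw
    have hzw : dist z w = (P.im - z.im) + τ' := by
      rw [dist_comm, dist_eq_norm, hw, add_sub_cancel_left, norm_mul, Complex.norm_real, Complex.norm_I, mul_one,
        Real.norm_eq_abs, abs_of_pos (by linarith)]
    have hwΩ : w ∈ Ω := by
      refine hwin ⟨?_, ?_⟩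
      · show P.im < w.im; rw [hw]; simp; linarith
      · rw [mem_ball]
        calc dist w P ≤ dist w z + dist z P := dist_triangle _ _ _
          _ < ((P.im - z.im) + τ') + ρ / 4 := by rw [dist_comm w z, hzw]; linarith
          _ ≤ ρ / 2 := by linarith
    have h := le_dist_of_mem_closure_sideZone hΩ hzcl hwΩ
    rw [hzw] at h
    linarith

/-- `gateV` misses the closure of every collar off a set containing `ball P (ρ/2)` (`0 < c`). -/
theorem gateV_disjoint_closure_collarZone {K : Set ℂ} {zf : ℂ} {c : ℝ} (hc : 0 < c) (hK : ball P (ρ / 2) ⊆ K)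
    (hρ : 0 ≤ ρ) : Disjoint (gateV P ρ t) (closure (collarZone K zf c)) := by
  rw [disjoint_left]
  intro z hz hzcl
  have h1 := le_infDist_of_mem_closure_collarZone hzcl
  have h2 : infDist z K = 0 := infDist_zero_of_mem (hK (ball_subset_ball (by linarith [hρ]) hz.1.1))
  linarith

end Strips

/-! ### The local boundary structure of the super-domain -/

/-- The open low box below the lowered window of the gate `P`. -/
theorem isOpen_lowBox (P : ℂ) (ρ : ℝ) :
    IsOpen {z : ℂ | |z.re - P.re| < ρ / 16 ∧ P.im - 7 * ρ / 16 < z.im ∧ z.im < P.im - ρ / 128} := by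
  have h1 : Continuous fun z : ℂ => |z.re - P.re| := continuous_abs.comp (Complex.continuous_re.sub continuous_const)
  exact (isOpen_lt h1 continuous_const).inter ((isOpen_lt continuous_const Complex.continuous_im).inter
    (isOpen_lt Complex.continuous_im continuous_const))

/-- The low box lies in the `σ`-shrunken lower half-window (`0 < ρ`, `σ ≤ ρ/256`). -/
theorem lowBox_subset_lowerWin {P : ℂ} {ρ σ : ℝ} (hρ : 0 < ρ) (hσ : σ ≤ ρ / 256) :
    {z : ℂ | |z.re - P.re| < ρ / 16 ∧ P.im - 7 * ρ / 16 < z.im ∧ z.im < P.im - ρ / 128} ⊆ lowerWin P ρ σ := by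
  rintro z ⟨hre, h1, h2⟩
  refine ⟨show z.im < P.im - σ by linarith, ?_⟩
  rw [mem_ball, dist_eq_norm]
  have hsq : ‖z - P‖ ^ 2 = (z.re - P.re) ^ 2 + (z.im - P.im) ^ 2 := by
    rw [Complex.sq_norm, Complex.normSq_apply, Complex.sub_re, Complex.sub_im]; ring
  have hre2 : (z.re - P.re) ^ 2 < (ρ / 16) ^ 2 := by
    have := abs_lt.1 hre; nlinarith
  have him2 : (z.im - P.im) ^ 2 < (7 * ρ / 16) ^ 2 := by nlinarith
  have hlt : ‖z - P‖ ^ 2 < (127 * ρ / 256) ^ 2 := by nlinarith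
  have h3 : ‖z - P‖ < 127 * ρ / 256 := by
    by_contra h
    push Not at h
    nlinarith [norm_nonneg (z - P)]
  linarith

/-- **THE LOCAL BOUNDARY STRUCTURE (LBS) OF THE SUPER-DOMAIN**; see the module docstring.  For the
super-domain `E ⊆ J` with `∂E ⊆ L₀ ∪ L₁ ∪ ∂J`, cuts `Lᵢ ⊆ gateO ∪ frameᵢ ∪ {xx}` with ends on `∂J`,
exit regions `Fᵢ ⊆ J` with closures off the compact `K ⊆ J` (`K = closure (D - τ)`, nonempty,
with connected complement not containing `z∞`), and frame boxes off `E`: there is `c₀ > 0` such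
that for `0 < σ ≤ ρ/256` and `0 < c ≤ c₀`, near every boundary point of `E` the set `E` lies in
`sideZone₀ σ ∪ sideZone₁ σ ∪ collarZone K z∞ c` or in a window strip `gateW Pᵢ ρ (2σ)`. -/
theorem localBoundaryStructure {N : ℕ} {E : Set ℂ} {J : JordanDomain} {L F B : Fin 2 → Set ℂ}
    {xx : Fin 2 → Fin 2 → ℂ} {P : Fin 2 → ℂ} {ρ : ℝ} {K : Set ℂ} {zf : ℂ} (Ksp : Fin 2 → Set ℂ)
    (cell conn : Fin 2 → Fin N → ℂ × ℝ) (hρ : 0 < ρ) (hEJ : E ⊆ J.carrier)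
    (hfrE : frontier E ⊆ L 0 ∪ L 1 ∪ frontier J.carrier)
    (hL : ∀ i, L i ⊆ gateO (B i) (F i) (P i) ρ ∪
      (segment ℝ (P i - ((ρ / 64 : ℝ) : ℂ) - ((ρ / 128 : ℝ) : ℂ) * Complex.I) (P i - ((ρ / 64 : ℝ) : ℂ)) ∪
        segment ℝ (P i - ((ρ / 64 : ℝ) : ℂ)) (P i + ((ρ / 64 : ℝ) : ℂ)) ∪
        segment ℝ (P i + ((ρ / 64 : ℝ) : ℂ)) (P i + ((ρ / 64 : ℝ) : ℂ) - ((ρ / 128 : ℝ) : ℂ) * Complex.I)) ∪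
      {xx i 0, xx i 1})
    (hxx : ∀ i k, xx i k ∈ frontier J.carrier) (hK : IsCompact K) (hKne : K.Nonempty) (hKc : IsPreconnected Kᶜ)
    (hzf : zf ∉ K) (hKJ : K ⊆ J.carrier) (hF : ∀ i, F i ⊆ J.carrier) (hFK : ∀ i, Disjoint (closure (F i)) K)
    (hbox : ∀ i (z : ℂ), |z.re - (P i).re| ≤ ρ / 64 → (P i).im - ρ / 128 ≤ z.im → z.im ≤ (P i).im → z ∉ E) :
    ∃ c₀ > (0 : ℝ), ∀ (σ c : ℝ), 0 < σ → σ ≤ ρ / 256 → 0 < c → c ≤ c₀ →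
      ∀ p ∈ frontier E, ∃ Nb ∈ 𝓝 p,
        Nb ∩ E ⊆ sideZone (P 0) ρ (Ksp 0) (B 0) (cell 0) (conn 0) σ ∪ sideZone (P 1) ρ (Ksp 1) (B 1) (cell 1) (conn 1) σ ∪
            collarZone K zf c ∨
          ∃ i, Nb ∩ E ⊆ gateW (P i) ρ (2 * σ) := by
  -- the distances of `∂J` and of the closed exit regions from `K`
  have hfrJc : IsCompact (frontier J.carrier) :=
    Metric.isCompact_of_isClosed_isBounded isClosed_frontier (J.isBounded.closure.subset frontier_subset_closure)
  have hfrJ : ∀ z ∈ frontier J.carrier, z ∉ J.carrier := fun z hz hzJ => hz.2 (by rwa [J.isOpen.interior_eq])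
  have hfrJK : Disjoint (frontier J.carrier) K := disjoint_left.2 fun z hz hzK => hfrJ z hz (hKJ hzK)
  obtain ⟨mJ, hmJ, hmJfar⟩ := exists_pos_forall_le_infDist hfrJc hK.isClosed hKne hfrJK
  have hmF : ∀ i, ∃ m > (0 : ℝ), ∀ p ∈ closure (F i), m ≤ infDist p K := fun i =>
    exists_pos_forall_le_infDist (J.isBounded.subset (hF i)).isCompact_closure hK.isClosed hKne (hFK i)
  choose mF hmF hmFfar using hmF
  set μ : ℝ := min mJ (min (mF 0) (mF 1)) with hμ
  have hμ0 : 0 < μ := lt_min hmJ (lt_min (hmF 0) (hmF 1))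
  -- the boundary points `μ`-far from `K` lie in one collar
  set T : Set ℂ := frontier E ∩ {p : ℂ | μ ≤ infDist p K} with hT
  have hEbd : IsBounded E := J.isBounded.subset hEJ
  have hTc : IsCompact T :=
    (Metric.isCompact_of_isClosed_isBounded isClosed_frontier (hEbd.closure.subset frontier_subset_closure)).inter_right
      (isClosed_le continuous_const (continuous_infDist_pt K))
  have hTK : Disjoint T K := disjoint_left.2 fun p hp hpK => by
    have h1 : μ ≤ infDist p K := hp.2
    rw [infDist_zero_of_mem hpK] at h1
    linarith
  obtain ⟨c₀, hc₀, hTcol⟩ := exists_subset_collarZone_of_isCompact hK hKne hKc hzf hTc hTK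
  refine ⟨c₀, hc₀, fun σ c hσ hσρ hc hcc₀ p hp => ?_⟩
  -- the collar alternative
  have hcol : μ ≤ infDist p K → ∃ Nb ∈ 𝓝 p,
      Nb ∩ E ⊆ sideZone (P 0) ρ (Ksp 0) (B 0) (cell 0) (conn 0) σ ∪ sideZone (P 1) ρ (Ksp 1) (B 1) (cell 1) (conn 1) σ ∪
          collarZone K zf c ∨
        ∃ i, Nb ∩ E ⊆ gateW (P i) ρ (2 * σ) := fun h =>
    ⟨collarZone K zf c₀, (isOpen_collarZone _).mem_nhds (hTcol ⟨hp, h⟩),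
      Or.inl fun z hz => Or.inr (collarZone_mono hcc₀ hz.1)⟩
  -- a side zone lies in the zone
  have hside : ∀ i, sideZone (P i) ρ (Ksp i) (B i) (cell i) (conn i) σ ⊆
      sideZone (P 0) ρ (Ksp 0) (B 0) (cell 0) (conn 0) σ ∪ sideZone (P 1) ρ (Ksp 1) (B 1) (cell 1) (conn 1) σ ∪
        collarZone K zf c := by
    refine Fin.forall_fin_two.2 ⟨fun z hz => Or.inl (Or.inl hz), fun z hz => Or.inl (Or.inr hz)⟩
  -- boundary points on a cut
  have hcut : ∀ i, p ∈ L i → ∃ Nb ∈ 𝓝 p,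
      Nb ∩ E ⊆ sideZone (P 0) ρ (Ksp 0) (B 0) (cell 0) (conn 0) σ ∪ sideZone (P 1) ρ (Ksp 1) (B 1) (cell 1) (conn 1) σ ∪
          collarZone K zf c ∨
        ∃ i, Nb ∩ E ⊆ gateW (P i) ρ (2 * σ) := by
    intro i hpi
    rcases hL i hpi with (hO | hfr') | hx
    · rcases hO with (⟨hlow, -⟩ | hbody) | hFi
      · refine ⟨_, (isOpen_lowBox (P i) ρ).mem_nhds hlow, Or.inl fun z hz => hside i ?_⟩
        exact Or.inl (Or.inl (Or.inl (lowBox_subset_lowerWin hρ hσρ hz.1)))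
      · refine ⟨{z : ℂ | infDist z (B i) < ρ / 8}, (isOpen_lt (continuous_infDist_pt _) continuous_const).mem_nhds hbody,
          Or.inl fun z hz => hside i (Or.inl (Or.inr ?_))⟩
        have h1 : infDist z (B i) < ρ / 8 := hz.1
        show infDist z (B i) < ρ / 4 - σ
        linarith
      · exact hcol ((min_le_right _ _).trans ((show min (mF 0) (mF 1) ≤ mF i by
          fin_cases i <;> simp).trans (hmFfar i p (subset_closure hFi))))
    · -- frame points: box coordinates
      obtain ⟨hre, h1, h2⟩ := frame_subset_rect (g := P i) (ρ' := ρ / 64) (h := ρ / 128) (by positivity) (by positivity) hfr'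
      have hpP : dist p (P i) ≤ 3 * ρ / 128 := by
        rw [dist_eq_norm]
        refine (Complex.norm_le_abs_re_add_abs_im _).trans ?_
        rw [Complex.sub_re, Complex.sub_im]
        have : |p.im - (P i).im| ≤ ρ / 128 := by rw [abs_le]; constructor <;> linarith
        linarith
      by_cases hd : σ < (P i).im - p.im
      · -- deep frame point: the lower half-window
        refine ⟨ball p ((P i).im - p.im - σ), ball_mem_nhds _ (by linarith), Or.inl fun z hz => hside i ?_⟩
        refine Or.inl (Or.inl (Or.inl ⟨?_, ?_⟩))
        · show z.im < (P i).im - σ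
          have h3 : dist z p < (P i).im - p.im - σ := mem_ball.1 hz.1
          have h4 : |(z - p).im| ≤ dist z p := by rw [dist_eq_norm]; exact Complex.abs_im_le_norm _
          rw [Complex.sub_im, abs_le] at h4
          linarith
        · rw [mem_ball]
          have h3 : dist z p < (P i).im - p.im - σ := mem_ball.1 hz.1
          linarith [dist_triangle z p (P i)]
      · -- shallow frame point: the window strip
        push Not at hd
        refine ⟨ball p (σ / 2), ball_mem_nhds _ (half_pos hσ), Or.inr ⟨i, fun z hz => ?_⟩⟩
        have h3 : dist z p < σ / 2 := mem_ball.1 hz.1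
        have h4 : |(z - p).im| ≤ dist z p := by rw [dist_eq_norm]; exact Complex.abs_im_le_norm _
        rw [Complex.sub_im, abs_le] at h4
        refine ⟨⟨?_, ?_⟩, fun hz' => hbox i z hz'.1 hz'.2.1 hz'.2.2 hz.2⟩
        · rw [mem_ball]; linarith [dist_triangle z p (P i)]
        · show (P i).im - 2 * σ < z.im
          linarith
    · have hx' : p ∈ frontier J.carrier := by
        rcases hx with rfl | rfl
        · exact hxx i 0
        · exact hxx i 1
      exact hcol ((min_le_left _ _).trans (hmJfar p hx'))
  rcases hfrE hp with (h0 | h1) | hJ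
  · exact hcut 0 h0
  · exact hcut 1 h1
  · exact hcol ((min_le_left _ _).trans (hmJfar p hJ))

/-- **Registered carrier `stub_carvedReduction_strips`** (crux item stmt-CriticalPhenomena-10472,
stub T-A′₂F `stub_carvedReduction_squeezeGeometry_domainsCoreF`, piece THE WINDOW STRIPS): a point
of the wide window region at or below the gate line lies beside the frame box. -/
theorem stub_carvedReduction_strips :
    ∀ (P : ℂ) (ρ t : ℝ) (z : ℂ), t ≤ ρ / 128 → z ∈ gateV P ρ t → z.im ≤ P.im → ρ / 64 < |z.re - P.re| :=
  fun _ _ _ _ ht hz hzim => abs_re_gt_of_mem_gateV ht hz hzim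

end Summit.CriticalPhenomena.SAWScalingLimit.Theorems.ObservableToSLE.TypeLadder

end
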